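import Literature.Barriers.CriticalPhenomena.EmbeddingModulusUniquenessProofs
import Literature.Probability.RandomPlanarGeometry.CrossRatioContinuity
import Literature.Probability.RandomPlanarGeometry.ImageUnivalent
import Literature.Probability.RandomPlanarGeometry.CardyFunctionIncBeta
import HarnessLib

/-!
# Stub `stub_identification` of line `Sketch`, crux `SegmentClosed` (stmt-CriticalPhenomena-5473)

Route `CardySelfDualSegment` of `CriticalPhenomena/CardyFormulaZ2`. The identification of the
limit modulus: if `CardyMod (t n) (α n)` holds along a sequence with `t n → t₀`, `α n → α₀`,
`im α₀ > 0`, and the crossing probabilities `P` are equicontinuous in the model parameter at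
`t₀` uniformly in the mesh (UM), then `CardyMod t₀ α₀`.

Proof. For `R = φ_{α₀}(R')` put `Q n = φ_{α n}(R')` (`MarkedDomain.map` by Beffara's shear
`shearHomeomorph`); the boundary loops `φ_{α n} ∘ ∂R'` converge uniformly to `φ_{α₀} ∘ ∂R'`
(`‖φ_a z - φ_b z‖ = ‖a - b‖ |im z|` and `∂R'` is bounded) and the marked points converge, so by
the continuity of the conformal modulus (Radó, `ConformalRectangle.tendsto_crossRatio_of_tendstoUniformly`)
the cross-ratios of `Q n` converge to that of `φ_{α₀}(R')`, which is that of `R` (same carrier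
and marked points, `ConformalRectangle.crossRatio_eq_of_image_data` with `h = id`). Cardy's
function is continuous on `[0, 1]` (`continuousOn_cardyFunction_holds`), and a `3ε` exchange of
limits through UM concludes.
-/

noncomputable section

open Set Filter Metric Complex
open scoped Topology
open UpperHalfPlane (upperHalfPlaneSet)
open Literature.Probability.RandomPlanarGeometry Literature.Barriers.CriticalPhenomena

namespace Summit.CriticalPhenomena.CardyFormulaZ2.Cruxes.SegmentClosed.Sketch

/-- Two shears differ at `z` by `(a - b) · im z`: `‖φ_a z - φ_b z‖ = ‖a - b‖ |im z|`. -/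
theorem norm_moduliShear_sub_moduliShear (a b z : ℂ) :
    ‖moduliShear a z - moduliShear b z‖ = ‖a - b‖ * |z.im| := by
  have h : moduliShear a z - moduliShear b z = (a - b) * (z.im : ℂ) := by
    unfold moduliShear; ring
  rw [h, norm_mul, Complex.norm_real, Real.norm_eq_abs]

/-- The shear `φ_β p` of a fixed point `p` depends continuously on `β`. -/
theorem tendsto_moduliShear_param {α : ℕ → ℂ} {α₀ : ℂ} (hα : Tendsto α atTop (𝓝 α₀)) (p : ℂ) :
    Tendsto (fun n => moduliShear (α n) p) atTop (𝓝 (moduliShear α₀ p)) := by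
  unfold moduliShear
  exact tendsto_const_nhds.add (hα.mul tendsto_const_nhds)

/-- The boundary loops of the sheared rectangles `φ_{α n}(R')` converge uniformly to that of
`φ_{α₀}(R')` when `α n → α₀` (the loop `∂R'` is bounded). -/
theorem tendstoUniformly_boundary_map_shear (R' : ConformalRectangle) {α : ℕ → ℂ} {α₀ : ℂ}
    (hα : Tendsto α atTop (𝓝 α₀)) (hαn : ∀ n, (α n).im ≠ 0) (hα₀ : α₀.im ≠ 0) :
    TendstoUniformly (fun n => (R'.map (shearHomeomorph (α n) (hαn n))).boundary)
      (R'.map (shearHomeomorph α₀ hα₀)).boundary atTop := by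
  -- a bound of the boundary loop
  have hb : Bornology.IsBounded (range R'.boundary) := by
    rw [R'.range_boundary]
    exact R'.isBounded.closure.subset frontier_subset_closure
  obtain ⟨M, hM, hMb⟩ := hb.exists_pos_norm_le
  have him : ∀ s, |(R'.boundary s).im| ≤ M := fun s =>
    (abs_im_le_norm _).trans (hMb _ (mem_range_self s))
  rw [Metric.tendstoUniformly_iff]
  intro ε hε
  filter_upwards [Metric.tendsto_nhds.1 hα (ε / M) (div_pos hε hM)] with n hn
  intro s
  show dist (moduliShear α₀ (R'.boundary s)) (moduliShear (α n) (R'.boundary s)) < ε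
  rw [dist_eq_norm, norm_moduliShear_sub_moduliShear]
  rw [dist_comm, dist_eq_norm] at hn
  calc ‖α₀ - α n‖ * |(R'.boundary s).im| ≤ ‖α₀ - α n‖ * M :=
        mul_le_mul_of_nonneg_left (him s) (norm_nonneg _)
    _ < ε / M * M := mul_lt_mul_of_pos_right hn hM
    _ = ε := div_mul_cancel₀ ε hM.ne'

/-- The marked points of the sheared rectangles `φ_{α n}(R')` converge to those of `φ_{α₀}(R')`
when `α n → α₀`. -/
theorem tendsto_pt_map_shear (R' : ConformalRectangle) {α : ℕ → ℂ} {α₀ : ℂ}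
    (hα : Tendsto α atTop (𝓝 α₀)) (hαn : ∀ n, (α n).im ≠ 0) (hα₀ : α₀.im ≠ 0) (i : Fin 4) :
    Tendsto (fun n => (R'.map (shearHomeomorph (α n) (hαn n))).pt i) atTop
      (𝓝 ((R'.map (shearHomeomorph α₀ hα₀)).pt i)) :=
  tendsto_moduliShear_param hα (R'.pt i)

/-- **Continuity of the modulus of the sheared rectangles.** If `α n → α₀` in `ℍ`, then for any
uniformizing data `(ψ n, y n)` of `φ_{α n}(R')` and `(φ, x)` of a conformal rectangle `R` with
the carrier and marked points of `φ_{α₀}(R')`, `crossRatio (y n) → crossRatio x` (Radó). -/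
theorem tendsto_crossRatio_shear (R R' : ConformalRectangle) {α : ℕ → ℂ} {α₀ : ℂ}
    (hα : Tendsto α atTop (𝓝 α₀)) (hαn : ∀ n, (α n).im ≠ 0) (hα₀ : α₀.im ≠ 0)
    (ψ : ∀ n, ConformalEquiv upperHalfPlaneSet (R'.map (shearHomeomorph (α n) (hαn n))).carrier)
    (y : ℕ → Fin 4 → ℝ) (hψ : ∀ n, (R'.map (shearHomeomorph (α n) (hαn n))).IsUniformizing (ψ n) (y n))
    (φ : ConformalEquiv upperHalfPlaneSet R.carrier) (x : Fin 4 → ℝ)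
    (hc : R.carrier = moduliShear α₀ '' R'.carrier) (hp : ∀ i, R.pt i = moduliShear α₀ (R'.pt i))
    (hu : R.IsUniformizing φ x) :
    Tendsto (fun n => crossRatio (y n)) atTop (𝓝 (crossRatio x)) := by
  obtain ⟨φ₀, x₀, hφ₀⟩ :=
    MarkedDomain.exists_isUniformizing_holds (R'.map (shearHomeomorph α₀ hα₀))
  have h := ConformalRectangle.tendsto_crossRatio_of_tendstoUniformly
    (tendstoUniformly_boundary_map_shear R' hα hαn hα₀) (tendsto_pt_map_shear R' hα hαn hα₀)
    ψ y hψ φ₀ x₀ hφ₀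
  have hx : crossRatio x₀ = crossRatio x :=
    ConformalRectangle.crossRatio_eq_of_image_data (h := id)
      (R := R'.map (shearHomeomorph α₀ hα₀)) (S := R) differentiableOn_id (injOn_id _)
      continuousOn_id (by rw [image_id, hc]; rfl) (fun i => by rw [hp i]; rfl) hφ₀ hu
  rwa [hx] at h

/-- **Identification of the limit modulus.** If `CardyMod (t n) (α n)` holds along a sequence
with `t n → t₀`, `α n → α₀`, `im α₀ > 0`, and the crossing probabilities `P` are equicontinuous
in the model parameter at `t₀` uniformly in the mesh (UM), then `CardyMod t₀ α₀`: for
`R = φ_{α₀}(R')` the moduli of `Q_n = φ_{α n}(R')` converge to that of `R` (Radó's theorem,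
`ConformalRectangle.tendsto_crossRatio_of_tendstoUniformly`, the sheared boundary loops
converging uniformly), `F` is continuous, and a `3ε` exchange of limits through UM concludes.
Stated for an abstract family `P`. -/
theorem stub_identification (P : unitInterval → ConformalRectangle → ℝ → ℝ)
    (t : ℕ → unitInterval) (t₀ : unitInterval) (α : ℕ → ℂ) (α₀ : ℂ)
    (ht : Tendsto t atTop (𝓝 t₀)) (hα : Tendsto α atTop (𝓝 α₀))
    (hαn : ∀ n, 0 < (α n).im) (hα₀ : 0 < α₀.im)
    (hUM : ∀ (R : ConformalRectangle) (ε : ℝ), 0 < ε → ∃ η > 0, ∀ s : unitInterval,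
      dist s t₀ < η → ∀ δ : ℝ, 0 < δ → |P s R δ - P t₀ R δ| < ε)
    (hmod : ∀ n (R R' : ConformalRectangle) (φ : ConformalEquiv upperHalfPlaneSet R.carrier)
      (x : Fin 4 → ℝ), R.carrier = moduliShear (α n) '' R'.carrier →
      (∀ i, R.pt i = moduliShear (α n) (R'.pt i)) → R.IsUniformizing φ x →
      Tendsto (P (t n) R') (𝓝[>] 0) (𝓝 (Literature.Probability.RandomPlanarGeometry.cardyFunction (crossRatio x))))
    (R R' : ConformalRectangle) (φ : ConformalEquiv upperHalfPlaneSet R.carrier) (x : Fin 4 → ℝ)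
    (hc : R.carrier = moduliShear α₀ '' R'.carrier) (hp : ∀ i, R.pt i = moduliShear α₀ (R'.pt i))
    (hu : R.IsUniformizing φ x) :
    Tendsto (P t₀ R') (𝓝[>] 0) (𝓝 (Literature.Probability.RandomPlanarGeometry.cardyFunction (crossRatio x))) := by
  -- uniformizing data of the sheared rectangles `Q n = φ_{α n}(R')`
  choose ψ y hψ using fun n =>
    MarkedDomain.exists_isUniformizing_holds (R'.map (shearHomeomorph (α n) (hαn n).ne'))
  -- `CardyMod (t n) (α n)` tested on `(Q n, R')`
  have hlim : ∀ n, Tendsto (P (t n) R') (𝓝[>] 0)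
      (𝓝 (Literature.Probability.RandomPlanarGeometry.cardyFunction (crossRatio (y n)))) :=
    fun n => hmod n _ R' (ψ n) (y n) rfl (fun _ => rfl) (hψ n)
  -- Radó: the moduli converge
  have hcr : Tendsto (fun n => crossRatio (y n)) atTop (𝓝 (crossRatio x)) :=
    tendsto_crossRatio_shear R R' hα (fun n => (hαn n).ne') hα₀.ne' ψ y hψ φ x hc hp hu
  -- `F` is continuous at `crossRatio x ∈ (0, 1)`
  have hxI : crossRatio x ∈ Ioo (0 : ℝ) 1 :=
    ConformalRectangle.crossRatio_mem_Ioo_of_isUniformizing hu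
  have hFc : ContinuousAt Literature.Probability.RandomPlanarGeometry.cardyFunction (crossRatio x) :=
    continuousOn_cardyFunction_holds.continuousAt (Icc_mem_nhds hxI.1 hxI.2)
  have hF : Tendsto (fun n => Literature.Probability.RandomPlanarGeometry.cardyFunction (crossRatio (y n)))
      atTop (𝓝 (Literature.Probability.RandomPlanarGeometry.cardyFunction (crossRatio x))) :=
    hFc.tendsto.comp hcr
  -- the `3ε` exchange of limits
  rw [Metric.tendsto_nhds]
  intro ε hε
  have hε3 : 0 < ε / 3 := by positivity
  obtain ⟨η, hη, hη'⟩ := hUM R' (ε / 3) hε3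
  obtain ⟨n, hn, hn'⟩ :=
    ((Metric.tendsto_nhds.1 ht η hη).and (Metric.tendsto_nhds.1 hF (ε / 3) hε3)).exists
  filter_upwards [Metric.tendsto_nhds.1 (hlim n) (ε / 3) hε3, self_mem_nhdsWithin]
    with δ hδ hδpos
  have h1 : dist (P t₀ R' δ) (P (t n) R' δ) < ε / 3 := by
    rw [Real.dist_eq, abs_sub_comm]
    exact hη' (t n) hn δ hδpos
  calc dist (P t₀ R' δ) (Literature.Probability.RandomPlanarGeometry.cardyFunction (crossRatio x))
      ≤ dist (P t₀ R' δ) (P (t n) R' δ)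
        + dist (P (t n) R' δ) (Literature.Probability.RandomPlanarGeometry.cardyFunction (crossRatio (y n)))
        + dist (Literature.Probability.RandomPlanarGeometry.cardyFunction (crossRatio (y n)))
            (Literature.Probability.RandomPlanarGeometry.cardyFunction (crossRatio x)) :=
        dist_triangle4 _ _ _ _
    _ < ε / 3 + ε / 3 + ε / 3 := add_lt_add (add_lt_add h1 hδ) hn'
    _ = ε := by ring

end Summit.CriticalPhenomena.CardyFormulaZ2.Cruxes.SegmentClosed.Sketch

end
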